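import Summits.NavierStokesRegularity.NavierStokesRegularity.Theses.AxisymmetricExtremality
import Summits.NavierStokesRegularity.NavierStokesRegularity.Theorems.AxisymmetricExtremalityAxisymmetricKatoGlobalReduction
import Summits.NavierStokesRegularity.NavierStokesRegularity.Theorems.AxisymmetricExtremalityAxisymmetricKatoGlobalStubTypeIITransfer
import Summits.NavierStokesRegularity.NavierStokesRegularity.Theorems.AxisymmetricExtremalityAxisymmetricKatoGlobalStubSeregin2020TypeIIDischarge
import Summits.NavierStokesRegularity.NavierStokesRegularity.Theorems.AxisymmetricExtremalityAxisymmetricKatoGlobalSwirlAxisModulusBelow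
import HarnessLib.Audit

/-!
# Strategist census companions (family `-s`, seat s19-g3) for the crux
# `AxisymmetricExtremality.AxisymmetricKatoGlobal` (stmt-NavierStokesRegularity-15453)

Typed companions of `STRATEGY-CENSUS-s19-g3.md` (all statements elaborate; every `theorem` is
proved, no `sorry`):

* §1 weaker intermediate `NoAxisymMinimalBlowupDatum` (W0) — exactly what `closes` consumes;
  `closes_of_noAxisymMinimal` (the route's deciding theorem re-proved from W0) and
  `noAxisymMinimal_of_crux` (W0 ⟸ crux).
* §2 decomposition D1 = criterion `SmallSwirlAxisRegularity` (P1, absolute local small-swirl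
  ε-regularity at axis points — OPEN in print) × a-priori `AxisSwirlVanishing` (P2, the swirl
  vanishes at axis points up to the top time, no rate); assembly `crux_of_D1` PROVED through the
  landed stubs 1, K, 2b' of the registered line; `axisSwirlVanishing_of_lt` records that P2 is
  trivial strictly below the lifespan (so its content is exactly the maximal-time case, like the
  lead's `stub_swirlAxisModulus` / `swirlAxisModulus_of_lt`).
* §3 strengthening S⁺ = `AxisTypeIBound` (scaled cubic quantity bounded at axis points = energy
  Type I); `crux_of_axisTypeIBound` PROVED from the DISCHARGED Seregin-2020 fact
  (`EulerScaling.stub_seregin2020TypeII`) and the landed transfer stub — S⁺ coincides with the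
  registered euler-scaling line's C⁺ = stub 4 ∧ stub 5, so it is not a new line.
-/

noncomputable section

set_option linter.dupNamespace false

open Set MeasureTheory Filter Topology Function Metric
open scoped ENNReal NNReal
open Literature.Analysis.FluidPDE Literature.Analysis.FunctionSpaces

namespace Summit.NavierStokesRegularity.NavierStokesRegularity.Cruxes.AxisymmetricKatoGlobal.StrategistS19g3

open Summit.NavierStokesRegularity.NavierStokesRegularity.Theses.AxisymmetricExtremality
open Summit.NavierStokesRegularity.NavierStokesRegularity.Theorems.AxisymmetricKatoGlobal

local notation "ℝ³" => EuclideanSpace ℝ (Fin 3)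

/-! ## §1 The weakest intermediate `closes` admits -/

/-- **W0.** No axisymmetric Rusin–Šverák minimal blow-up datum exists (for any viscosity): the
literal instance of the crux consumed by `closes`. -/
def NoAxisymMinimalBlowupDatum : Prop :=
  ∀ ν : ℝ, 0 < ν → ∀ (u₀ : ℝ³ → ℝ³) (g : HomSobolev ℝ³ (EuclideanSpace ℂ (Fin 3)) (1 / 2 : ℝ)),
    IsMinimalBlowupDatum ν u₀ g → IsAxisymmetric u₀ → False

/-- W0 follows from the crux (one line). -/
theorem noAxisymMinimal_of_crux (h : AxisymmetricKatoGlobal) : NoAxisymMinimalBlowupDatum := by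
  intro ν hν u₀ g hmin hax
  obtain ⟨hL3, hrep, hdiv, -, hnot⟩ := hmin
  exact hnot (h ν hν u₀ g hL3 hrep hdiv (fun θ x => hax θ x))

/-- The route's deciding theorem re-proved with W0 in place of the crux (same three lines of
logic as `Theses.AxisymmetricExtremality.closes`). -/
theorem closes_of_noAxisymMinimal (h₂ : MinimalDatumPFold) (h₄ : PFoldToAxisymmetric)
    (hW : NoAxisymMinimalBlowupDatum) : _root_.NavierStokesRegularity := by
  show Literature.NS.NavierStokesExistenceSmoothR3
  intro ν hν u₀ hsm hdiv hdec
  by_contra hno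
  obtain ⟨u₁, g, hmin, hax⟩ := h₄ ν hν (h₂ ν hν ⟨u₀, hsm, hdiv, hdec, hno⟩)
  exact hW ν hν u₁ g hmin (fun θ x => hax θ x)

/-! ## §2 Decomposition D1: absolute small-swirl criterion × a-priori swirl vanishing -/

/-- **P1 (criterion, OPEN in print).** Absolute local small-swirl ε-regularity at axis points for
smooth axisymmetric Kato solutions: there is a universal `ε > 0` such that `|Γ| ≤ ε ν` on a
backward parabolic cylinder at an axis point forces boundedness near the top. (Lei–Ren 2024,
Thm 3 / Prop 17 give only RELATIVE smallness `ε = ε(local energies)`; the absolute form is stated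
there as beyond existing methods.) -/
def SmallSwirlAxisRegularity : Prop :=
  ∃ ε : ℝ, 0 < ε ∧ ∀ ν : ℝ, 0 < ν → ∀ T : ℝ, 0 < T → ∀ (u₀ : ℝ³ → ℝ³) (u : ℝ → ℝ³ → ℝ³),
    IsKatoSolutionOn T ν u₀ u → ContDiffOn ℝ (⊤ : ℕ∞) (uncurry u) (Ioo 0 T ×ˢ univ) →
    (∀ t ∈ Ioo 0 T, IsAxisymmetric (u t)) →
    ∀ x₀ : ℝ³, cylRadius x₀ = 0 → ∀ r : ℝ, 0 < r → r ^ 2 < T →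
      (∀ t ∈ Ioo (T - r ^ 2) T, ∀ x ∈ ball x₀ r, |swirl (u t) x| ≤ ε * ν) →
      IsBoundedNearTop u T x₀

/-- **P2 (a priori, OPEN).** The swirl `Γ = swirl (u t)` of a smooth axisymmetric Kato solution on
`[0, T)` vanishes at every axis point UP TO the (possibly maximal) time `T`: for every `ε > 0`
some backward parabolic cylinder at `(T, x₀)` has `|Γ| ≤ ε ν`. No rate is asked. -/
def AxisSwirlVanishing : Prop :=
  ∀ ν : ℝ, 0 < ν → ∀ T : ℝ, 0 < T → ∀ (u₀ : ℝ³ → ℝ³)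
    (g : HomSobolev ℝ³ (EuclideanSpace ℂ (Fin 3)) (1 / 2 : ℝ)) (u : ℝ → ℝ³ → ℝ³),
    g.Represents (Literature.Analysis.FunctionSpaces.EuclideanSpace.complexify ∘ u₀) →
    IsKatoSolutionOn T ν u₀ u → ContDiffOn ℝ (⊤ : ℕ∞) (uncurry u) (Ioo 0 T ×ˢ univ) →
    (∀ t ∈ Ioo 0 T, IsAxisymmetric (u t)) →
    ∀ x₀ : ℝ³, cylRadius x₀ = 0 → ∀ ε : ℝ, 0 < ε →
      ∃ r : ℝ, 0 < r ∧ r ^ 2 < T ∧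
        ∀ t ∈ Ioo (T - r ^ 2) T, ∀ x ∈ ball x₀ r, |swirl (u t) x| ≤ ε * ν

/-- **Assembly of D1 (proved).** P1 → P2 → crux, through the LANDED stubs of the registered line:
the singular point of a non-global axisymmetric Kato solution (stub 1), the pressure / local
energy classes near the top (stub K) and off-axis boundedness (stub 2b'). -/
theorem crux_of_D1 (h₁ : SmallSwirlAxisRegularity) (h₂ : AxisSwirlVanishing) :
    AxisymmetricKatoGlobal := by
  obtain ⟨ε, hε, hP1⟩ := h₁
  intro ν hν u₀ g hL3 hrep hdiv hax
  have hax' : IsAxisymmetric u₀ := fun θ x => hax θ x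
  by_contra hng
  obtain ⟨T, hT, xs, u, hK, hsm, haxi, hsing⟩ :=
    Registered.stub_katoAxisymSingularPoint ν hν u₀ hL3 hdiv hax' hng
  obtain ⟨p, _hpax, hsw, hloc⟩ :=
    Registered.stub_katoLocalEnergyNearTop ν hν T hT u₀ u hK hsm haxi
  have hbdd : IsBoundedNearTop u T xs := by
    by_cases h0 : cylRadius xs = 0
    · obtain ⟨r, hr, hrT, hsmall⟩ := h₂ ν hν T hT u₀ g u hrep hK hsm haxi xs h0 ε hε
      exact hP1 ν hν T hT u₀ u hK hsm haxi xs h0 r hr hrT hsmall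
    · exact Registered.stub_offAxisBounded_of_localEnergy ν hν T hT u p hsm haxi hsw hloc xs h0
  obtain ⟨r, hr, K, hbd⟩ := hbdd
  exact absurd (hsing r hr) (Registered.eLpNorm_parabolicCylinder_lt_top_of_forall_le hbd).ne

/-- If `x₀` lies on the axis then the cylindrical radius is bounded by the distance to `x₀`. -/
theorem cylRadius_le_norm_sub_of_axis {x₀ : ℝ³} (h0 : cylRadius x₀ = 0) (x : ℝ³) :
    cylRadius x ≤ ‖x - x₀‖ := by
  obtain ⟨ha, hb⟩ := (cylRadius_eq_zero_iff x₀).1 h0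
  rw [cylRadius, EuclideanSpace.norm_eq, Fin.sum_univ_three]
  apply Real.sqrt_le_sqrt
  simp only [PiLp.sub_apply, ha, hb, sub_zero, Real.norm_eq_abs, sq_abs]
  nlinarith [sq_nonneg (x 2 - x₀ 2)]

/-- **P2 is trivial strictly below the lifespan** (the analogue of the tree's
`Registered.swirlAxisModulus_of_lt` for the lead's stub): if the Kato solution lives on `[0, T')`
with `T < T'` and is continuous on the open strip, then at every axis point and every `ε > 0`
some backward cylinder at `(T, x₀)` has `|Γ| ≤ ε ν` — because `u` is bounded by some `M` on
`(T/2, T) × ℝ³` (Kato smoothing + continuity) and `|Γ(t,x)| ≤ 2 r ‖u(t,x)‖ ≤ 2 r M`.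
Hence the content of P2 is exactly the case `T = T_max(u₀)`. -/
theorem axisSwirlVanishing_of_lt :
    ∀ (ν T T' : ℝ) (u₀ : ℝ³ → ℝ³) (u : ℝ → ℝ³ → ℝ³),
      0 < ν → 0 < T → T < T' → IsKatoSolutionOn T' ν u₀ u →
      ContinuousOn (uncurry u) (Ioo 0 T' ×ˢ univ) →
      ∀ x₀ : ℝ³, cylRadius x₀ = 0 → ∀ ε : ℝ, 0 < ε →
        ∃ r : ℝ, 0 < r ∧ r ^ 2 < T ∧
          ∀ t ∈ Ioo (T - r ^ 2) T, ∀ x ∈ ball x₀ r, |swirl (u t) x| ≤ ε * ν := by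
  intro ν T T' u₀ u hν hT hTT' hu hcont x₀ hx₀ ε hε
  have ha : 0 < T / 2 := by linarith
  obtain ⟨M, hM⟩ := hu.exists_ae_norm_le_of_pos hν ha hTT'
  have hopen : IsOpen (Ioo (T / 2) T ×ˢ (univ : Set ℝ³)) := isOpen_Ioo.prod isOpen_univ
  have hsub : Ioo (T / 2) T ×ˢ (univ : Set ℝ³) ⊆ Ioo 0 T' ×ˢ univ :=
    prod_mono (fun t ht => ⟨ha.trans ht.1, ht.2.trans hTT'⟩) Subset.rfl
  have hbd : ∀ z ∈ Ioo (T / 2) T ×ˢ (univ : Set ℝ³), ‖uncurry u z‖ ≤ M :=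
    SereginSverak2009.forall_le_of_ae_le_of_continuousOn hopen (hcont.mono hsub).norm
      continuousOn_const hM
  have hM0 : 0 ≤ M := by
    have := hbd (3 * T / 4, 0) ⟨⟨by linarith, by linarith⟩, mem_univ _⟩
    exact (norm_nonneg _).trans this
  -- choose `r` with `r² < T/2` and `2 r M ≤ ε ν`
  set r : ℝ := min (Real.sqrt (T / 2) / 2) (ε * ν / (2 * M + 1)) with hr_def
  have hden : 0 < 2 * M + 1 := by linarith
  have hr : 0 < r := lt_min (by positivity) (div_pos (mul_pos hε hν) hden)
  have hr1 : r ≤ Real.sqrt (T / 2) / 2 := min_le_left _ _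
  have hr2 : r ≤ ε * ν / (2 * M + 1) := min_le_right _ _
  have hsqrt : Real.sqrt (T / 2) ^ 2 = T / 2 := Real.sq_sqrt (by linarith)
  have hrT2 : r ^ 2 < T / 2 := by
    have h1 : r ^ 2 ≤ (Real.sqrt (T / 2) / 2) ^ 2 := by
      exact pow_le_pow_left₀ hr.le hr1 2
    have h2 : (Real.sqrt (T / 2) / 2) ^ 2 = (T / 2) / 4 := by rw [div_pow, hsqrt]; norm_num
    linarith
  refine ⟨r, hr, by linarith, ?_⟩
  intro t ht x hx
  have htx : (t, x) ∈ Ioo (T / 2) T ×ˢ (univ : Set ℝ³) :=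
    ⟨⟨by linarith [ht.1], ht.2⟩, mem_univ _⟩
  have hux : ‖u t x‖ ≤ M := hbd (t, x) htx
  have hcr : cylRadius x ≤ r :=
    (cylRadius_le_norm_sub_of_axis hx₀ x).trans (le_of_lt (by simpa [dist_eq_norm] using hx))
  have h2rM : 2 * r * M ≤ ε * ν := by
    have : r * (2 * M + 1) ≤ ε * ν := by
      rw [← le_div_iff₀ hden]; exact hr2
    nlinarith
  calc |swirl (u t) x| ≤ 2 * cylRadius x * ‖u t x‖ :=
        Registered.abs_swirl_le_two_mul_cylRadius_mul_norm (u t) x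
    _ ≤ 2 * r * M := by gcongr
    _ ≤ ε * ν := h2rM

/-! ## §3 Strengthening S⁺ = energy Type I at axis points (coincides with stubs 4 ∧ 5) -/

/-- **S⁺.** The scaled cubic quantity `C(r) = r⁻² ∫_{Q_r(T,x₀)} |u|³` of a smooth axisymmetric
Kato solution stays bounded as `r → 0` at every axis point of the top time (= Type I in the
energy sense = the conjunction of the registered stubs 4 and 5 of `Lines/euler_scaling.lean`). -/
def AxisTypeIBound : Prop :=
  ∀ ν : ℝ, 0 < ν → ∀ T : ℝ, 0 < T → ∀ (u₀ : ℝ³ → ℝ³)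
    (g : HomSobolev ℝ³ (EuclideanSpace ℂ (Fin 3)) (1 / 2 : ℝ)) (u : ℝ → ℝ³ → ℝ³),
    g.Represents (Literature.Analysis.FunctionSpaces.EuclideanSpace.complexify ∘ u₀) →
    IsKatoSolutionOn T ν u₀ u → ContDiffOn ℝ (⊤ : ℕ∞) (uncurry u) (Ioo 0 T ×ˢ univ) →
    (∀ t ∈ Ioo 0 T, IsAxisymmetric (u t)) →
    ∀ x₀ : ℝ³, cylRadius x₀ = 0 →
      limsup (fun r => cknC r ((T, x₀) : ℝ × ℝ³) u) (𝓝[>] 0) < ∞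

/-- **S⁺ → crux (proved, unconditionally):** Seregin 2020 Thm 2.1 is now a kernel theorem
(`EulerScaling.stub_seregin2020TypeII`, 2026-08-28), so energy-Type-I control at axis points
gives boundedness there (`EulerScaling.stub_typeII_transfer`), and the landed stubs 1, K, 2b'
finish as in `Lines/euler_scaling.lean`. -/
theorem crux_of_axisTypeIBound (hS : AxisTypeIBound) : AxisymmetricKatoGlobal := by
  intro ν hν u₀ g hL3 hrep hdiv hax
  have hax' : IsAxisymmetric u₀ := fun θ x => hax θ x
  by_contra hng
  obtain ⟨T, hT, xs, u, hK, hsm, haxi, hsing⟩ :=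
    Registered.stub_katoAxisymSingularPoint ν hν u₀ hL3 hdiv hax' hng
  obtain ⟨p, hpax, hsw, hloc⟩ :=
    Registered.stub_katoLocalEnergyNearTop ν hν T hT u₀ u hK hsm haxi
  have hbdd : IsBoundedNearTop u T xs := by
    by_cases h0 : cylRadius xs = 0
    · exact EulerScaling.stub_typeII_transfer EulerScaling.stub_seregin2020TypeII ν hν T hT u p hsm
        haxi hpax hsw hloc xs h0 (hS ν hν T hT u₀ g u hrep hK hsm haxi xs h0)
    · exact Registered.stub_offAxisBounded_of_localEnergy ν hν T hT u p hsm haxi hsw hloc xs h0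
  obtain ⟨r, hr, K, hbd⟩ := hbdd
  exact absurd (hsing r hr) (Registered.eLpNorm_parabolicCylinder_lt_top_of_forall_le hbd).ne

end Summit.NavierStokesRegularity.NavierStokesRegularity.Cruxes.AxisymmetricKatoGlobal.StrategistS19g3

end
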